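import Summits.QuantumFields.BalabanUV.T4Continuum.Support.NE9ChartFaceOperator
import Summits.QuantumFields.BalabanUV.T4Continuum.Support.B13HistMeasurable
import Summits.QuantumFields.BalabanUV.T4Continuum.Support.NE9TableReading

/-!
# NE9ChartFaceTable — the NE9 CHART FACE, TABLE HALF: the sourcing map `iRecC` reading the END's channel table (ℓ^∞(ι, ℂ), the
# (1.36)-weighted reading `NE9TableReading.readingρ`) into NE5's MEASURABLE history space `B13HistM P` along a coordinate
# identification `c` (recombined pullback, measurable branch), and the JUNCTION with WALL §2 A1: the table two-point clause of
# `actNE9 ∕ actChart` from NE5-side Hist-Lipschitz activities + a Lipschitz sourcing map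
# (cell `pub-balaban`, T4-DAG §2 node U3 ∕ §6 NE9; BINDER row NE9 OWNER lineage `b2b-balaban-t4-ne9-p1`, generation 33;
# sheet `t4/b2b-balaban-t4-ne9-p1/g32/TABLE-HALF-NE9-g32.md` §1 «(iRecC)» ∕ §4 (1), CARVER-NOTES g32 §4 (1))

HONEST FRAMING (T4-DAG PAGE 1).  Rung (B)+1 of the FINITE-VOLUME T⁴ programme — NOT infinite volume, NOT a mass gap, NOT the
Clay problem.  NE9 (`T4OutputRate.NE9` ∧ `FadingMemory`) is a cell NEW ESTIMATE, NOT PRINTED in [I] = [Balaban1987RG1]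
(CMP **109**), [II] = [Balaban1988RG2Cluster] (CMP **116**), and NOT PROVED for Bałaban's E^{(j)} («NE9 ⇐ the named binders»;
0∕18 leaves instantiated on Bałaban's objects; spine PROVED 0∕9).  HONEST DEPENDENCY (cell line, verbatim): continuum YM on T⁴ ⇐
BetaPertH ∧ nine spine estimates (0/9 proved); BetaPertH ⇐ (D1) ∧ (D4) ∧ CAP+tail; G-an2-4 gates asym, D1 and NE2/3/4.
`FlowStep.BetaPertH`, (B), (B^μ) do not occur.  DATA definitions + sup-norm bookkeeping; no `def … : Prop` beyond Mathlib's, no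
estimate of any object of the series; quotations for TYPES only (ABSOLUTE RULE).  0 sorry.

WHY THIS FILE.  The END of record applied to the recursion-defined functional (`NE9EndApplied`, p223763) reads the channel table
`Q : ι → ℝ` into `Pot := lp (fun _ : ι => ℂ) ∞` by `readingρ wt k` (p223302) and hands it to `act : ℕ → ℝ → E → Pot → G.P → ℂ`.
At the chart face `act := actChart S raw ch iRec` (p221235) NE5's activity of record `activity (b13InnerData R) S.act (k+1) op hist`
wants the table as an INSERTED HISTORY `hist : Hist`; for the step of record `Hist` is the MEASURABLE history space `B13HistM P`
(`B13HistMeasurable`: tables of `V″(Y, φ)`, `Q(Y, φ, b, b′)` measurable in the field argument `φ` — the space on which (2.14)'s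
fluctuation integral is typed).  The END's index `ι ∋ y` codes POINTWISE the piece values at `(Y, chart point A, φ, entry tag)`
([II] (1.33) p. 9: 𝐕′_k(Y, U_{k+1}, B′) is read AT the background; sheet §1 (ι)), so the sourcing map at the chart point `A` is
a PULLBACK along a coordinate identification `c k A : PotIdx P → τ → ι` with a finite RECOMBINATION `Σ_t w_t · Q′(c k A i t)`
(pure pullback `τ = Unit`; real∕imaginary pair `τ = Fin 2`, `w = (1, I)` for the re∕im-doubled channel of `NE9ComplexEncoding`),
followed by the MEASURABLE BRANCH (an arbitrary bounded table need not be measurable in `φ`; the junk value `0` is never met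
by the END's binders, which live on the readings `𝒜 k` of ARISING tables — row REG «arising tables are regular», [II] (1.34) p. 9,
DISPLAYED as `𝒜 k ⊆ regTables …`).  THIS FILE:
* §1 (frame level, `P : PotFrame C`) `combWt w := Σ_t ‖w_t‖`, **`histOfComb P c w : lp (fun _ : ι => ℂ) ∞ →L[ℂ] B13Hist P`**
  (stored entry `i ↦ Σ_t w_t · Q′(c i t)`; `histOfComb_apply`, `norm_histOfComb_le : ‖histOfComb P c w‖ ≤ combWt w`,
  `norm_histOfComb_sub_le`, physical entries `Vpp_histOfComb ∕ Qker_histOfComb`); `unitW` (`combWt = 1`), `reImW` (`combWt = 2`);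
* §2 (measurable frame, `P : MeasPotFrame C`) **`regTables P c w`** := `measTables.comap (histOfComb …)` (a ℂ-submodule of `Pot`:
  the tables whose recombined pullback is measurable), **`iRecC P c w : ℕ → ℝ → Bg → Pot → B13HistM P`** (the recombined pullback
  on `regTables`, `0` off it; LAST-COUPLING-BLIND `iRecC_indep` = the D-6 companion of `oRecChart`), `iRecC_coe_of_mem`,
  `norm_iRecC_le`, **`norm_iRecC_sub_le_of_mem`** (Lipschitz `combWt w` on regular tables), `VppM_iRecC_of_mem ∕ QkerM_iRecC_of_mem`,
  and THE VALUES OF AN ARISING TABLE RECOVERED: **`VppM_iRecC_readingρ`** — for `Q` in the level-`k` weighted box and weights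
  MATCHED along `c` (`wt k (c k A i t) = idxWt i`), `V″(iRecC … (readingρ wt k Q)) (Y, φ) = Σ_t w_t · Q (c k A (rem Y φ) t)`;
* §3 THE JUNCTION WITH A1 (`TwoPointKP`, table clause (ii) of `U3PolymerDictionaryKP.twoPointKP_cubeChart_of_domains`):
  **`tableTwoPoint_actNE9`** — for a TABLE-BLIND operator sourcing map `oRec` (D-6), NE5-side Hist-Lipschitz of
  `activity (b13InnerData R) S.act (k+1) (oRec …)` on sets `ℋ k ⊆ Hist` with a nonnegative modulus `m`, and `iRec k s A` mapping
  `𝒜 k` into `ℋ k` with Lipschitz constant `L k` there ⇒ the clause with `lip := L`, `n₅ := m`; **`tableTwoPoint_actChart_iRecC`**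
  — the same for `actChart S raw ch (iRecC P c w)` (`oRecChart` is table-blind by `rfl`), `lip k := combWt w`, under REG.
WHAT STAYS DISPLAYED: REG; NE5-side Hist-Lipschitz + size + Kotecký–Preiss clauses ((B)'s interior (R-1), WALL §2 A1); the
coordinate identification `c` and matched weights (instancer's bookkeeping = O-NE9-1 proper); species DATA; N1∕N2.  DISGUISE TEST:
a reading map, its sup-norm Lipschitz property and a triangle-free composition; no activity is estimated; not NE9.

References (TYPES ∕ loci only): [Balaban1988RG2Cluster] T. Bałaban, CMP **116** (1988) 1–22, (1.33)–(1.36) p. 9, (1.41)–(1.43)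
p. 11, (2.14)–(2.15) p. 15; [Balaban1987RG1] T. Bałaban, CMP **109** (1987) 249–301, (2.13)–(2.14) p. 268.  Summits-side NEW work
(LEAN PLACEMENT RULE); imports `NE9ChartFaceOperator` (p221235), `B13HistMeasurable` (NE5 leaf-06), `NE9TableReading` (p223302)
BY NAME; modifies nothing.  Value = the last NE9-owned TYPE on the row's instantiation path (the `Hist` slot), NOT summit progress.
-/

noncomputable section

open scoped BigOperators ENNReal

namespace Summit.QuantumFields.BalabanUV.T4Continuum.NE9ChartFaceTable

open Literature.MathematicalPhysics.QuantumFieldTheory.Balaban1983to89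
open Literature.MathematicalPhysics.QuantumFieldTheory.Balaban1983to89.T4OutputRate (Carriers)
open Summit.QuantumFields.BalabanUV.T4Continuum.B13HistDatum
open Summit.QuantumFields.BalabanUV.T4Continuum.B13HistMeasurable
open Summit.QuantumFields.BalabanUV.T4Continuum.NE9TableReading

/-! ## §1 The recombined pullback of a channel table into the potential frame (frame level) -/

section Frame

variable {C : Carriers} (P : PotFrame C) {ι τ : Type*} [Fintype τ]

/-- [folklore] DATA: the recombination weight `Σ_t ‖w_t‖` (the Lipschitz constant of the recombined pullback). -/
def combWt (w : τ → ℂ) : ℝ := ∑ t, ‖w t‖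

/-- [folklore] `0 ≤ combWt w`. -/
theorem combWt_nonneg (w : τ → ℂ) : 0 ≤ combWt w := Finset.sum_nonneg fun t _ => norm_nonneg (w t)

/-- [folklore] DATA: the recombined pulled-back STORED table `e ↦ Σ_t w_t · Q′ (c e.idx t)` on the entries of the frame. -/
def combFun (c : PotIdx P → τ → ι) (w : τ → ℂ) (Q' : ι → ℂ) : Entry P.frame → ℂ := fun e => ∑ t, w t * Q' (c e.idx t)

/-- [folklore] `combFun` unfolds. -/
@[simp] theorem combFun_apply (c : PotIdx P → τ → ι) (w : τ → ℂ) (Q' : ι → ℂ) (e : Entry P.frame) :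
    combFun P c w Q' e = ∑ t, w t * Q' (c e.idx t) := rfl

/-- [folklore] every recombined entry of a bounded table is at most `combWt w · ‖Q′‖`. -/
theorem norm_combFun_le (c : PotIdx P → τ → ι) (w : τ → ℂ) (Q' : lp (fun _ : ι => ℂ) ∞) (e : Entry P.frame) :
    ‖combFun P c w Q' e‖ ≤ combWt w * ‖Q'‖ := by
  rw [combFun_apply, combWt, Finset.sum_mul]
  refine (norm_sum_le _ _).trans (Finset.sum_le_sum fun t _ => ?_)
  rw [norm_mul]
  exact mul_le_mul_of_nonneg_left (lp.norm_apply_le_norm ENNReal.top_ne_zero Q' _) (norm_nonneg _)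

/-- [folklore] DATA: the recombined pullback as a ℂ-LINEAR map into the history space of the frame. -/
def histOfCombLin (c : PotIdx P → τ → ι) (w : τ → ℂ) : lp (fun _ : ι => ℂ) ∞ →ₗ[ℂ] B13Hist P where
  toFun Q' := BoundedContinuousFunction.ofNormedAddCommGroupDiscrete (combFun P c w Q') (combWt w * ‖Q'‖)
    (norm_combFun_le P c w Q')
  map_add' Q' Q'' := by
    ext e
    simp only [BoundedContinuousFunction.coe_ofNormedAddCommGroupDiscrete, BoundedContinuousFunction.coe_add, Pi.add_apply,
      combFun_apply, lp.coeFn_add, mul_add, Finset.sum_add_distrib]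
  map_smul' z Q' := by
    ext e
    simp only [BoundedContinuousFunction.coe_ofNormedAddCommGroupDiscrete, BoundedContinuousFunction.coe_smul, Pi.smul_apply,
      combFun_apply, lp.coeFn_smul, smul_eq_mul, RingHom.id_apply, Finset.mul_sum]
    refine Finset.sum_congr rfl fun t _ => ?_
    ring

/-- [folklore] DATA: **THE RECOMBINED PULLBACK** `histOfComb P c w : ℓ^∞(ι, ℂ) →L[ℂ] B13Hist P` — stored entry
`i ↦ Σ_t w_t · Q′(c i t)`, a bounded ℂ-linear map of norm `≤ combWt w`. [cite: Balaban1988RG2Cluster, (1.33)-(1.36) p.9] -/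
def histOfComb (c : PotIdx P → τ → ι) (w : τ → ℂ) : lp (fun _ : ι => ℂ) ∞ →L[ℂ] B13Hist P :=
  (histOfCombLin P c w).mkContinuous (combWt w) fun Q' =>
    (BoundedContinuousFunction.norm_le (mul_nonneg (combWt_nonneg w) (norm_nonneg _))).2 (norm_combFun_le P c w Q')

/-- [folklore] the stored entries of the recombined pullback. -/
@[simp] theorem histOfComb_apply (c : PotIdx P → τ → ι) (w : τ → ℂ) (Q' : lp (fun _ : ι => ℂ) ∞) (e : Entry P.frame) :
    histOfComb P c w Q' e = ∑ t, w t * Q' (c e.idx t) := rfl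

/-- [folklore] **`‖histOfComb P c w Q′‖ ≤ combWt w · ‖Q′‖`.** -/
theorem norm_histOfComb_apply_le (c : PotIdx P → τ → ι) (w : τ → ℂ) (Q' : lp (fun _ : ι => ℂ) ∞) :
    ‖histOfComb P c w Q'‖ ≤ combWt w * ‖Q'‖ :=
  (BoundedContinuousFunction.norm_le (mul_nonneg (combWt_nonneg w) (norm_nonneg _))).2 (norm_combFun_le P c w Q')

/-- [folklore] **`‖histOfComb P c w‖ ≤ combWt w`.** -/
theorem norm_histOfComb_le (c : PotIdx P → τ → ι) (w : τ → ℂ) : ‖histOfComb P c w‖ ≤ combWt w :=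
  LinearMap.mkContinuous_norm_le _ (combWt_nonneg w) _

/-- [folklore] **LIPSCHITZ**: `‖histOfComb Q′ − histOfComb Q″‖ ≤ combWt w · ‖Q′ − Q″‖` (linearity). -/
theorem norm_histOfComb_sub_le (c : PotIdx P → τ → ι) (w : τ → ℂ) (Q' Q'' : lp (fun _ : ι => ℂ) ∞) :
    ‖histOfComb P c w Q' - histOfComb P c w Q''‖ ≤ combWt w * ‖Q' - Q''‖ := by
  rw [← map_sub]; exact norm_histOfComb_apply_le P c w _

/-- [folklore] the PHYSICAL remainder entry of the recombined pullback: `V″ (Y, φ) = idxWt(rem Y φ) · Σ_t w_t · Q′(c (rem Y φ) t)`. -/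
theorem Vpp_histOfComb (c : PotIdx P → τ → ι) (w : τ → ℂ) (Q' : lp (fun _ : ι => ℂ) ∞) (Y : C.Dom) (φ : P.Arg Y) :
    P.Vpp (histOfComb P c w Q') Y φ = (P.idxWt (.rem Y φ) : ℂ) * ∑ t, w t * Q' (c (.rem Y φ) t) := rfl

/-- [folklore] the PHYSICAL kernel entry of the recombined pullback. -/
theorem Qker_histOfComb (c : PotIdx P → τ → ι) (w : τ → ℂ) (Q' : lp (fun _ : ι => ℂ) ∞) (Y : C.Dom) (φ : P.Arg Y)
    (b b' : P.Bond Y) :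
    P.Qker (histOfComb P c w Q') Y φ b b' = (P.idxWt (.ker Y φ b b') : ℂ) * ∑ t, w t * Q' (c (.ker Y φ b b') t) := rfl

/-- [folklore] DATA: the trivial recombination (pure pullback). -/
def unitW : Unit → ℂ := fun _ => 1

/-- [folklore] DATA: the real∕imaginary recombination `(1, I)` (for the re∕im-doubled channel of `NE9ComplexEncoding`). -/
def reImW : Fin 2 → ℂ := ![1, Complex.I]

/-- [folklore] `combWt unitW = 1`. -/
theorem combWt_unitW : combWt unitW = 1 := by simp [combWt, unitW]

/-- [folklore] `combWt reImW = 2`. -/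
theorem combWt_reImW : combWt reImW = 2 := by
  simp [combWt, reImW, Fin.sum_univ_two]
  norm_num

/-- [folklore] the pure pullback stores `Q′(c₁ i)`. -/
theorem histOfComb_unit_apply (c₁ : PotIdx P → ι) (Q' : lp (fun _ : ι => ℂ) ∞) (e : Entry P.frame) :
    histOfComb P (fun i (_ : Unit) => c₁ i) unitW Q' e = Q' (c₁ e.idx) := by
  simp [histOfComb_apply, unitW]

/-- [folklore] the re∕im recombination stores `Q′(c i 0) + I · Q′(c i 1)`. -/
theorem histOfComb_reIm_apply (c : PotIdx P → Fin 2 → ι) (Q' : lp (fun _ : ι => ℂ) ∞) (e : Entry P.frame) :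
    histOfComb P c reImW Q' e = Q' (c e.idx 0) + Complex.I * Q' (c e.idx 1) := by
  simp [histOfComb_apply, reImW, Fin.sum_univ_two]

end Frame

/-! ## §2 The sourcing map `iRecC` into the MEASURABLE history space (measurable branch) -/

section Meas

variable {C : Carriers} (P : MeasPotFrame C) {ι τ : Type*} [Fintype τ] {Bg : Type*}

/-- [folklore] DATA: **THE REGULAR TABLES** along `c` — the tables of `ℓ^∞(ι, ℂ)` whose recombined pullback is a MEASURABLE potential
table (`B13HistMeasurable.measTables`), a ℂ-submodule (comap of a submodule under a linear map).  Row REG displays that the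
readings of ARISING tables lie here. [cite: Balaban1988RG2Cluster, (1.34) p.9] -/
def regTables (c : PotIdx P.toPotFrame → τ → ι) (w : τ → ℂ) : Submodule ℂ (lp (fun _ : ι => ℂ) ∞) :=
  P.measTables.comap (histOfComb P.toPotFrame c w).toLinearMap

/-- [folklore] membership in `regTables`. -/
theorem mem_regTables {c : PotIdx P.toPotFrame → τ → ι} {w : τ → ℂ} {Q' : lp (fun _ : ι => ℂ) ∞} :
    Q' ∈ regTables P c w ↔ P.IsMeasTable (histOfComb P.toPotFrame c w Q') := Iff.rfl

open Classical in
/-- [folklore] DATA: **THE TABLE SOURCING MAP OF THE CHART FACE** `iRecC P c w k s A Q′ : B13HistM P` — the recombined pullback of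
`Q′` along the level-`k`, chart-point-`A` coordinate identification `c k A`, packaged as a measurable table when it is one, the
zero table otherwise; the last coupling `s` is NOT read (D-6). [cite: Balaban1988RG2Cluster, (1.33)-(1.36) p.9 and (2.14) p.15] -/
def iRecC (c : ℕ → Bg → PotIdx P.toPotFrame → τ → ι) (w : τ → ℂ) : ℕ → ℝ → Bg → lp (fun _ : ι => ℂ) ∞ → B13HistM P :=
  fun k _ A Q' => if h : Q' ∈ regTables P (c k A) w then ⟨histOfComb P.toPotFrame (c k A) w Q', h⟩ else 0

variable {P}
variable {c : ℕ → Bg → PotIdx P.toPotFrame → τ → ι} {w : τ → ℂ}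

/-- [folklore] **D-6 COMPANION**: `iRecC` does not read the last coupling. -/
theorem iRecC_indep (P : MeasPotFrame C) (c : ℕ → Bg → PotIdx P.toPotFrame → τ → ι) (w : τ → ℂ) (k : ℕ) (s s' : ℝ)
    (A : Bg) : iRecC P c w k s A = iRecC P c w k s' A := rfl

/-- [folklore] on a regular table `iRecC` IS the recombined pullback. -/
theorem iRecC_coe_of_mem {k : ℕ} (s : ℝ) {A : Bg} {Q' : lp (fun _ : ι => ℂ) ∞} (h : Q' ∈ regTables P (c k A) w) :
    ((iRecC P c w k s A Q' : B13HistM P) : B13Hist P.toPotFrame) = histOfComb P.toPotFrame (c k A) w Q' := by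
  simp only [iRecC, dif_pos h]

/-- [folklore] off the regular tables `iRecC` is the zero table (junk branch, never met by the END's binders under REG). -/
theorem iRecC_of_not_mem {k : ℕ} (s : ℝ) {A : Bg} {Q' : lp (fun _ : ι => ℂ) ∞} (h : Q' ∉ regTables P (c k A) w) :
    iRecC P c w k s A Q' = 0 := by
  simp only [iRecC, dif_neg h]

/-- [folklore] **SIZE**: `‖iRecC … Q′‖ ≤ combWt w · ‖Q′‖` (both branches). -/
theorem norm_iRecC_le (k : ℕ) (s : ℝ) (A : Bg) (Q' : lp (fun _ : ι => ℂ) ∞) :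
    ‖iRecC P c w k s A Q'‖ ≤ combWt w * ‖Q'‖ := by
  by_cases h : Q' ∈ regTables P (c k A) w
  · rw [Submodule.coe_norm, iRecC_coe_of_mem s h]
    exact norm_histOfComb_apply_le _ _ _ _
  · rw [iRecC_of_not_mem s h, norm_zero]
    exact mul_nonneg (combWt_nonneg w) (norm_nonneg _)

/-- [folklore] **LIPSCHITZ ON THE REGULAR TABLES**: `‖iRecC … Q′ − iRecC … Q″‖ ≤ combWt w · ‖Q′ − Q″‖` for `Q′, Q″` regular. -/
theorem norm_iRecC_sub_le_of_mem {k : ℕ} (s : ℝ) {A : Bg} {Q' Q'' : lp (fun _ : ι => ℂ) ∞}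
    (h' : Q' ∈ regTables P (c k A) w) (h'' : Q'' ∈ regTables P (c k A) w) :
    ‖iRecC P c w k s A Q' - iRecC P c w k s A Q''‖ ≤ combWt w * ‖Q' - Q''‖ := by
  rw [Submodule.coe_norm, Submodule.coe_sub, iRecC_coe_of_mem s h', iRecC_coe_of_mem s h'']
  exact norm_histOfComb_sub_le _ _ _ _ _

/-- [folklore] `iRecC` maps the regular tables of the ball of radius `S` into the ball of radius `combWt w · S`. -/
theorem norm_iRecC_le_of_norm_le {k : ℕ} (s : ℝ) {A : Bg} {Q' : lp (fun _ : ι => ℂ) ∞} {S : ℝ} (hS : ‖Q'‖ ≤ S) :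
    ‖iRecC P c w k s A Q'‖ ≤ combWt w * S :=
  (norm_iRecC_le k s A Q').trans (mul_le_mul_of_nonneg_left hS (combWt_nonneg w))

/-- [folklore] the remainder entry `V″` of `iRecC` at a regular table. -/
theorem VppM_iRecC_of_mem {k : ℕ} (s : ℝ) {A : Bg} {Q' : lp (fun _ : ι => ℂ) ∞} (h : Q' ∈ regTables P (c k A) w)
    (Y : C.Dom) (φ : P.Arg Y) :
    P.VppM (iRecC P c w k s A Q') Y φ = (P.idxWt (.rem Y φ) : ℂ) * ∑ t, w t * Q' (c k A (.rem Y φ) t) := by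
  rw [MeasPotFrame.VppM, iRecC_coe_of_mem s h]; rfl

/-- [folklore] the kernel entry `Q` of `iRecC` at a regular table. -/
theorem QkerM_iRecC_of_mem {k : ℕ} (s : ℝ) {A : Bg} {Q' : lp (fun _ : ι => ℂ) ∞} (h : Q' ∈ regTables P (c k A) w)
    (Y : C.Dom) (φ : P.Arg Y) (b b' : P.Bond Y) :
    P.QkerM (iRecC P c w k s A Q') Y φ b b' = (P.idxWt (.ker Y φ b b') : ℂ) * ∑ t, w t * Q' (c k A (.ker Y φ b b') t) := by
  rw [MeasPotFrame.QkerM, iRecC_coe_of_mem s h]; rfl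

/-- [folklore] **THE VALUES OF AN ARISING TABLE, RECOVERED** (remainder entries): for a real channel table `Q` in the level-`k`
weighted box (`|Q y| ≤ wt k y · S`, positive weights), read by `readingρ wt k` (p223302) into a REGULAR table, with the weights
MATCHED along the identification (`wt k (c k A (rem Y φ) t) = idxWt (rem Y φ)` — the instancer's bookkeeping: the END's weight
letter at a `V″`-coded index IS the (1.36) format), the physical remainder entry of the sourced history is the recombined VALUE
`Σ_t w_t · Q (c k A (rem Y φ) t)` — e.g. `Q(y_re) + I · Q(y_im)` for `reImW`. [cite: Balaban1988RG2Cluster, (1.36) p.9] -/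
theorem VppM_iRecC_readingρ {wt : ℕ → ι → ℝ} (hwt : ∀ k y, 0 < wt k y) {k : ℕ} (s : ℝ) {A : Bg} {Q : ι → ℝ} {S : ℝ}
    (hbox : ∀ y, |Q y| ≤ wt k y * S) (h : readingρ wt k Q ∈ regTables P (c k A) w) (Y : C.Dom) (φ : P.Arg Y)
    (hmatch : ∀ t, wt k (c k A (.rem Y φ) t) = P.idxWt (.rem Y φ)) :
    P.VppM (iRecC P c w k s A (readingρ wt k Q)) Y φ = ∑ t, w t * (Q (c k A (.rem Y φ) t) : ℂ) := by
  rw [VppM_iRecC_of_mem s h, Finset.mul_sum]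
  refine Finset.sum_congr rfl fun t _ => ?_
  have hval : (readingρ wt k Q : ι → ℂ) (c k A (.rem Y φ) t) = ((Q (c k A (.rem Y φ) t) / wt k (c k A (.rem Y φ) t) : ℝ) : ℂ) :=
    reading_apply_of_bound (hwt k) hbox _
  rw [hval, hmatch t, Complex.ofReal_div]
  have hw : (P.idxWt (.rem Y φ) : ℂ) ≠ 0 := Complex.ofReal_ne_zero.2 (P.idxWt_pos _).ne'
  field_simp

/-- [folklore] the same for the kernel entries. -/
theorem QkerM_iRecC_readingρ {wt : ℕ → ι → ℝ} (hwt : ∀ k y, 0 < wt k y) {k : ℕ} (s : ℝ) {A : Bg} {Q : ι → ℝ} {S : ℝ}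
    (hbox : ∀ y, |Q y| ≤ wt k y * S) (h : readingρ wt k Q ∈ regTables P (c k A) w) (Y : C.Dom) (φ : P.Arg Y)
    (b b' : P.Bond Y) (hmatch : ∀ t, wt k (c k A (.ker Y φ b b') t) = P.idxWt (.ker Y φ b b')) :
    P.QkerM (iRecC P c w k s A (readingρ wt k Q)) Y φ b b' = ∑ t, w t * (Q (c k A (.ker Y φ b b') t) : ℂ) := by
  rw [QkerM_iRecC_of_mem s h, Finset.mul_sum]
  refine Finset.sum_congr rfl fun t _ => ?_
  have hval : (readingρ wt k Q : ι → ℂ) (c k A (.ker Y φ b b') t) =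
      ((Q (c k A (.ker Y φ b b') t) / wt k (c k A (.ker Y φ b b') t) : ℝ) : ℂ) :=
    reading_apply_of_bound (hwt k) hbox _
  rw [hval, hmatch t, Complex.ofReal_div]
  have hw : (P.idxWt (.ker Y φ b b') : ℂ) ≠ 0 := Complex.ofReal_ne_zero.2 (P.idxWt_pos _).ne'
  field_simp

end Meas

/-! ## §3 The junction with A1: the table two-point clause of `actNE9` ∕ `actChart` -/

section Junction

open Summit.QuantumFields.BalabanUV.T4Continuum.B13Carriers (TwoRuns)
open Summit.QuantumFields.BalabanUV.T4Continuum.B13DomainGeometryTR (SCube footprint)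
open Summit.QuantumFields.BalabanUV.T4Continuum.B13InnerData (b13InnerData)
open Summit.QuantumFields.BalabanUV.T4Continuum.B13OpDatum (OpDatum)
open Summit.QuantumFields.BalabanUV.T4Continuum.B13StepOfRecord (Slots)
open Summit.QuantumFields.BalabanUV.T4Continuum.B13OutKPForm (activity)
open Summit.QuantumFields.BalabanUV.T4Continuum.U3PolymerDictionaryNE9Face (actNE9 actNE9_footprint)
open Summit.QuantumFields.BalabanUV.T4Continuum.NE9ChartFaceOperator (oRecChart actChart)

variable {G : Type} [GaugeGroup G] {R : TwoRuns G} {E : Type} {IOp Hist : Type*} [NormedAddCommGroup Hist] [NormedSpace ℂ Hist]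
  (S : Slots R E IOp Hist)

/-- [folklore] **THE TABLE TWO-POINT CLAUSE OF `actNE9` FROM THE NE5 SIDE + A LIPSCHITZ SOURCING MAP.**  Let the operator sourcing
map `oRec` be TABLE-BLIND (D-6: the operator datum reads the last coupling and the background, not the table), let NE5's activity
of record at the sourced datum be Lipschitz in the inserted history on sets `ℋ k ⊆ Hist` with a nonnegative modulus `m`
(DISPLAYED — (B)'s interior: [II] (2.15)–(2.22) with two tables, NOT PRINTED), and let the history sourcing map `iRec k s A` send the
admissible tables `𝒜 k` into `ℋ k` with Lipschitz constant `L k` there.  Then clause (ii) of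
`U3PolymerDictionaryKP.twoPointKP_cubeChart_of_domains` holds for `act₅ := activity … ∘ (oRec, iRec)` = `actNE9 S oRec iRec` at
footprints, with `lip := L` and majorant `n₅ := m`. [cite: Balaban1988RG2Cluster, (2.14)-(2.15) p.15] -/
theorem tableTwoPoint_actNE9 {Bg : Type} {Pot : Type*} [NormedAddCommGroup Pot] {W : Set (ℕ → ℝ)}
    (oRec : ℕ → ℝ → Bg → Pot → OpDatum E) (iRec : ℕ → ℝ → Bg → Pot → Hist) {𝒜 : ℕ → Set Pot} {ℋ : ℕ → Set Hist}
    {m : ℕ → ℝ → Bg → R.carriers.Dom → ℝ} {L : ℕ → ℝ}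
    (hbl : ∀ (k : ℕ) (s : ℝ) (A : Bg) (Q Q' : Pot), oRec k s A Q = oRec k s A Q')
    (hm : ∀ k s A Z, 0 ≤ m k s A Z)
    (hH : ∀ g ∈ W, ∀ (k : ℕ) (A : Bg) (X : R.carriers.Dom), R.carriers.scale X = k + 1 → ∀ Q ∈ 𝒜 k,
      ∀ h ∈ ℋ k, ∀ h' ∈ ℋ k, ∀ Z ∈ R.domAt X.1,
        ‖activity (b13InnerData R) S.act (k + 1) (oRec k (g k) A Q) h Z -
            activity (b13InnerData R) S.act (k + 1) (oRec k (g k) A Q) h' Z‖ ≤ m k (g k) A Z * ‖h - h'‖)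
    (hinto : ∀ (k : ℕ) (s : ℝ) (A : Bg), ∀ Q ∈ 𝒜 k, iRec k s A Q ∈ ℋ k)
    (hL : ∀ (k : ℕ) (s : ℝ) (A : Bg), ∀ Q ∈ 𝒜 k, ∀ Q' ∈ 𝒜 k, ‖iRec k s A Q - iRec k s A Q'‖ ≤ L k * ‖Q - Q'‖) :
    ∀ g ∈ W, ∀ (k : ℕ) (A : Bg) (X : R.carriers.Dom), R.carriers.scale X = k + 1 → ∀ Q ∈ 𝒜 k, ∀ Q' ∈ 𝒜 k,
      ∀ Z ∈ R.domAt X.1,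
        ‖actNE9 S oRec iRec k (g k) A Q (footprint Z) - actNE9 S oRec iRec k (g k) A Q' (footprint Z)‖ ≤
          L k * ‖Q - Q'‖ * m k (g k) A Z := by
  intro g hg k A X hX Q hQ Q' hQ' Z hZ
  rw [actNE9_footprint, actNE9_footprint, hbl k (g k) A Q' Q]
  calc ‖activity (b13InnerData R) S.act (k + 1) (oRec k (g k) A Q) (iRec k (g k) A Q) Z -
          activity (b13InnerData R) S.act (k + 1) (oRec k (g k) A Q) (iRec k (g k) A Q') Z‖
      ≤ m k (g k) A Z * ‖iRec k (g k) A Q - iRec k (g k) A Q'‖ :=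
        hH g hg k A X hX Q hQ _ (hinto k _ A Q hQ) _ (hinto k _ A Q' hQ') Z hZ
    _ ≤ m k (g k) A Z * (L k * ‖Q - Q'‖) := mul_le_mul_of_nonneg_left (hL k _ A Q hQ Q' hQ') (hm k _ A Z)
    _ = L k * ‖Q - Q'‖ * m k (g k) A Z := by ring

/-- [folklore] `oRecChart` is TABLE-BLIND (its table argument is not read — D-6 at the chart, p221235). -/
theorem oRecChart_tableBlind {Bg TD : Type} {Pot : Type*} (raw : (ℕ → ℝ) → TD → ℕ → E → ℂ) (ch : Bg → TD) (k : ℕ) (s : ℝ)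
    (A : Bg) (Q Q' : Pot) : oRecChart S raw ch k s A Q = oRecChart S raw ch k s A Q' := rfl

/-- [folklore] **THE TABLE TWO-POINT CLAUSE AT THE CHART FACE WITH THE SOURCING MAP OF RECORD.**  For the step of record with
MEASURABLE history space (`Hist := B13HistM P`), `act := actChart S raw ch (iRecC P c w)`: under REG (`𝒜 k ⊆ regTables P (c k A) w`
at every chart point), NE5-side Hist-Lipschitz on sets `ℋ k` containing the sourced histories of the admissible tables, modulus
`m ≥ 0` — clause (ii) of `twoPointKP_cubeChart_of_domains` with `lip k := combWt w` (pure pullback: `1`; re∕im: `2`).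
[cite: Balaban1988RG2Cluster, (1.34)-(1.36) p.9 and (2.14)-(2.15) p.15] -/
theorem tableTwoPoint_actChart_iRecC {P : MeasPotFrame R.carriers}
    (S : Slots R E IOp (B13HistM P)) {ι τ : Type*} [Fintype τ] {Bg TD : Type} {W : Set (ℕ → ℝ)}
    (raw : (ℕ → ℝ) → TD → ℕ → E → ℂ) (ch : Bg → TD) (c : ℕ → Bg → PotIdx P.toPotFrame → τ → ι) (w : τ → ℂ)
    {𝒜 : ℕ → Set (lp (fun _ : ι => ℂ) ∞)} {ℋ : ℕ → Set (B13HistM P)} {m : ℕ → ℝ → Bg → R.carriers.Dom → ℝ}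
    (hREG : ∀ (k : ℕ) (A : Bg), 𝒜 k ⊆ regTables P (c k A) w)
    (hm : ∀ k s A Z, 0 ≤ m k s A Z)
    (hH : ∀ g ∈ W, ∀ (k : ℕ) (A : Bg) (X : R.carriers.Dom), R.carriers.scale X = k + 1 → ∀ Q ∈ 𝒜 k,
      ∀ h ∈ ℋ k, ∀ h' ∈ ℋ k, ∀ Z ∈ R.domAt X.1,
        ‖activity (b13InnerData R) S.act (k + 1) (oRecChart S raw ch k (g k) A Q) h Z -
            activity (b13InnerData R) S.act (k + 1) (oRecChart S raw ch k (g k) A Q) h' Z‖ ≤ m k (g k) A Z * ‖h - h'‖)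
    (hinto : ∀ (k : ℕ) (s : ℝ) (A : Bg), ∀ Q ∈ 𝒜 k, iRecC P c w k s A Q ∈ ℋ k) :
    ∀ g ∈ W, ∀ (k : ℕ) (A : Bg) (X : R.carriers.Dom), R.carriers.scale X = k + 1 → ∀ Q ∈ 𝒜 k, ∀ Q' ∈ 𝒜 k,
      ∀ Z ∈ R.domAt X.1,
        ‖actChart S raw ch (iRecC P c w) k (g k) A Q (footprint Z) - actChart S raw ch (iRecC P c w) k (g k) A Q' (footprint Z)‖ ≤
          combWt w * ‖Q - Q'‖ * m k (g k) A Z :=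
  tableTwoPoint_actNE9 S (oRecChart S raw ch) (iRecC P c w) (L := fun _ => combWt w) (oRecChart_tableBlind S raw ch) hm hH hinto
    fun k s A _ hQ _ hQ' => norm_iRecC_sub_le_of_mem s (hREG k A hQ) (hREG k A hQ')

end Junction

end Summit.QuantumFields.BalabanUV.T4Continuum.NE9ChartFaceTable

end
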